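import Summits.HodgeConjecture.CorCM.MumfordTateRankSimpleThreefoldTimesTwoCurves
import Summits.HodgeConjecture.CorCM.MumfordTateRankNonSimpleFourfolds
import Summits.HodgeConjecture.CorCM.MumfordTateRankSurfaceTimesThreefold
import Summits.HodgeConjecture.CorCM.MumfordTateRankCurveTimesTwoSurfaces
import Summits.HodgeConjecture.CorCM.MumfordTateRankSurfaceTimesCurves
import HarnessLib

/-!
# The Mumford–Tate rank of a non-simple complex abelian FIVEFOLD without a simple fourfold factor lies in
# `{2, …, 18, 20, 22, 23, 24, 25, 26, 28, 32}` (Poincaré + the partition tables {2,3}, {1,1,3}, {1,2,2}, {2,1,1,1}, {1,1,1,1,1})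

COR-CM (cell `pub-hodgecm2`, seat `b27` gen 50, count-neutral Mumford–Tate-rank ladder; theorems only, no definition, no named fact;
UNCONDITIONAL — nothing here uses or asserts HC_CM).  Notation `t(X) = dim MT(H¹X)`.

A non-simple fivefold is `E × F` (`F` a fourfold) or `S × T` (Poincaré).  If it is not «a curve times a SIMPLE fourfold», every isogeny shape is one of the
five partitions whose tables are in the tree, each exact in every cell:
* `{2,3}`   simple surface × simple threefold: `{6, 7, 10, 12, 13, 14, 16, 20, 24, 25, 28, 32}` (`CorCM/MumfordTateRankSurfaceTimesThreefold`);
* `{1,1,3}` simple threefold × two curves: `{4, 5, 6, 7, 8, 10, 11, 12, 13, 14, 16, 23, 24, 25, 26, 28}` (`CorCM/MumfordTateRankSimpleThreefoldTimesTwoCurves`);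
* `{1,2,2}` curve × two simple surfaces: `{4, …, 18, 20, 22, 24}` (`CorCM/MumfordTateRankCurveTimesTwoSurfaces`);
* `{2,1,1,1}` simple surface × three curves: `{4, …, 18, 20}` (`CorCM/MumfordTateRankSurfaceTimesCurves`);
* `{1,1,1,1,1}` five curves: `{2, …, 14, 16}` (`CorCM/MumfordTateRankProductsOfCurves`).

* §0 Poincaré: `exists_prod_isIsogenous_of_not_isSimple_fivefold` (`(1,4)` or `(2,3)`); five curves as a biproduct; a commutation helper.
* §1 **`mtRank_hodge_one_mem_of_not_isSimple_fivefold`** — the union `{2, …, 18, 20, 22, 23, 24, 25, 26, 28, 32}`; so a non-simple fivefold with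
  `t ∈ {19, 21, 27, 29, 30, 31}` or `t ≥ 33` is a curve times a simple fourfold.

## References
* [MoonenZarhin1999LowDim] B. Moonen, Yu. G. Zarhin, *Hodge classes on abelian varieties of low dimension*, Math. Ann. 315 (1999), §2 (2.2)–(2.5), §3,
  §5 [corpus: paper:arxiv-math_9901113 pp. 5–7, 10]. [cite: MoonenZarhin1999LowDim, §3 and §5 (5.4)]
* [MumfordAV1970] D. Mumford, *Abelian Varieties* (1970), §19 Thm. 1 (Poincaré's complete reducibility) and Cor. 1–2. [cite: MumfordAV1970, §19 Thm. 1]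
-/

noncomputable section

open CategoryTheory CategoryTheory.Limits Module

namespace Summit.HodgeConjecture.CorCM

open Literature.AlgebraicGeometry.Motives
open Literature.AlgebraicGeometry.Motives.AbelianVariety
open Literature.AlgebraicGeometry.Motives.HodgeStructure
open Literature.AlgebraicGeometry.HodgeTheory
open Literature.AlgebraicGeometry.Milne1999 (IsOfCMType)

variable [HodgeTensorFacts.{0, 0}] {X : AbelianVariety ℂ} {n : ℕ}

/-! ## §0 Poincaré for fivefolds; five curves as a biproduct; a commutation helper -/

omit [HodgeTensorFacts.{0, 0}] in
/-- **A non-simple abelian fivefold is isogenous to `A × B` with `(dim A, dim B) = (1, 4)` or `(2, 3)`** (an abelian subvariety and its Poincaré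
complement; swap if the subvariety has dimension `3` or `4`). [cite: MumfordAV1970, §19 Thm. 1] [cite: MoonenZarhin1999LowDim, §3 and §5 (5.4)] -/
theorem exists_prod_isIsogenous_of_not_isSimple_fivefold (hX5 : X.dim = 5) (hns : ¬ X.IsSimple) :
    ∃ A B : AbelianVariety ℂ, (A.dim = 1 ∧ B.dim = 4 ∨ A.dim = 2 ∧ B.dim = 3) ∧ IsIsogenous X (A.prod B) := by
  obtain ⟨B, f, hf, hB0, hBX⟩ := exists_abelianSubvariety_of_not_isSimple hns
  haveI := hf
  obtain ⟨Z, j, _, hσ⟩ := poincare_complete_reducibility f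
  have hdim : B.dim + Z.dim = X.dim := by
    rw [← dim_prod, ← dim_eq_of_isIsogeny (isIsogeny_hom_of_iso (biprodIsoProd B Z)), dim_eq_of_isIsogeny hσ]
  have hiso : IsIsogenous X (B.prod Z) :=
    IsIsogenous.symm' ⟨(biprodIsoProd B Z).inv ≫ biprod.desc f j, isIsogeny_comp (isIsogeny_hom_of_iso (biprodIsoProd B Z).symm) hσ⟩
  rcases (by omega : B.dim = 1 ∨ B.dim = 2 ∨ B.dim = 3 ∨ B.dim = 4) with h1 | h2 | h3 | h4
  · exact ⟨B, Z, Or.inl ⟨h1, by omega⟩, hiso⟩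
  · exact ⟨B, Z, Or.inr ⟨h2, by omega⟩, hiso⟩
  · exact ⟨Z, B, Or.inr ⟨by omega, h3⟩, hiso.trans (Literature.AlgebraicGeometry.HodgeTheory.isIsogenous_prod_comm B Z)⟩
  · exact ⟨Z, B, Or.inl ⟨by omega, h4⟩, hiso.trans (Literature.AlgebraicGeometry.HodgeTheory.isIsogenous_prod_comm B Z)⟩

omit [HodgeTensorFacts.{0, 0}] in
/-- `E₀ × (E₁ × (E₂ × (E₃ × E₄))) ∼ ⨁_{Fin 5} ![E₀, E₁, E₂, E₃, E₄]`. [cite: MumfordAV1970, §19 Thm. 1] -/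
theorem isIsogenous_prod_prod_prod_prod_biproduct_five (E₀ E₁ E₂ E₃ E₄ : AbelianVariety ℂ) :
    IsIsogenous (E₀.prod (E₁.prod (E₂.prod (E₃.prod E₄)))) (⨁ (![E₀, E₁, E₂, E₃, E₄] : Fin 5 → AbelianVariety ℂ)) := by
  obtain ⟨h, g, hhg, hgh⟩ := AndreRiemann.biproduct_succ_split (![E₀, E₁, E₂, E₃, E₄] : Fin 5 → AbelianVariety ℂ)
  have hh : IsIsogeny h := isIsogeny_of_comp_eq_of_comp_eq (isIsogeny_id _) (isIsogeny_id _) hgh hhg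
  have htail : (![E₀, E₁, E₂, E₃, E₄] : Fin 5 → AbelianVariety ℂ) ∘ Fin.succ = ![E₁, E₂, E₃, E₄] := funext fun i => by
    fin_cases i <;> rfl
  have h1 : IsIsogenous (⨁ (![E₀, E₁, E₂, E₃, E₄] : Fin 5 → AbelianVariety ℂ))
      (E₀.prod (⨁ ((![E₀, E₁, E₂, E₃, E₄] : Fin 5 → AbelianVariety ℂ) ∘ Fin.succ))) := ⟨h, hh⟩
  rw [htail] at h1
  exact (h1.trans ((IsIsogenous.refl E₀).prod (isIsogenous_prod_prod_prod_biproduct_four E₁ E₂ E₃ E₄).symm')).symm'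

omit [HodgeTensorFacts.{0, 0}] in
/-- `A × (B × (C × D)) ∼ D × (A × (B × C))`. [cite: MumfordAV1970, §19 Thm. 1] -/
theorem isIsogenous_prod_prod_prod_rotate (A B C D : AbelianVariety ℂ) : IsIsogenous (A.prod (B.prod (C.prod D))) (D.prod (A.prod (B.prod C))) :=
  ((IsIsogenous.refl A).prod (((IsIsogenous.refl B).prod (isIsogenous_prod_comm C D)).trans
      ((Literature.AlgebraicGeometry.HodgeTheory.isIsogenous_prod_assoc B D C).symm'.trans
        (((isIsogenous_prod_comm B D).prod (IsIsogenous.refl C)).trans (Literature.AlgebraicGeometry.HodgeTheory.isIsogenous_prod_assoc D B C))))).trans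
    ((Literature.AlgebraicGeometry.HodgeTheory.isIsogenous_prod_assoc A D (B.prod C)).symm'.trans
      (((isIsogenous_prod_comm A D).prod (IsIsogenous.refl _)).trans (Literature.AlgebraicGeometry.HodgeTheory.isIsogenous_prod_assoc D A (B.prod C))))

/-! ## §1 The membership theorem -/

/-- **The Mumford–Tate rank of a NON-SIMPLE complex abelian fivefold that is not a curve times a simple fourfold lies in
`{2, …, 18, 20, 22, 23, 24, 25, 26, 28, 32}`.**  Cases `E × F` with `F` a non-simple fourfold (`F ∼ E' × T`: `{1,1,3}`, `{2,1,1,1}` or five curves;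
`F ∼ S × S'`: `{1,2,2}`, `{2,1,1,1}` or five curves) and `S × T` (`{2,3}`, `{1,2,2}`, `{2,1,1,1}`, `{1,1,3}`, five curves).
[cite: MoonenZarhin1999LowDim, §3 and §5 (5.4)] [cite: MumfordAV1970, §19 Thm. 1] -/
theorem mtRank_hodge_one_mem_of_not_isSimple_fivefold (hX : IsSmoothProjective n X.X) (hX5 : X.dim = 5) (hns : ¬ X.IsSimple)
    (h4 : ∀ A B : AbelianVariety ℂ, A.dim = 1 → B.dim = 4 → IsIsogenous X (A.prod B) → ¬ B.IsSimple) :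
    haveI := BettiUniverse.finite hX 1
    (BettiUniverse.hodge exists_isReal_hodgeModel_holds hX 1).mtRank ∈
      ({2, 3, 4, 5, 6, 7, 8, 9, 10, 11, 12, 13, 14, 15, 16, 17, 18, 20, 22, 23, 24, 25, 26, 28, 32} : Finset ℕ) := by
  classical
  haveI := BettiUniverse.finite hX 1
  -- the five leaves
  have leafT : ∀ {S T : AbelianVariety ℂ}, S.IsSimple → S.dim = 2 → T.IsSimple → T.dim = 3 → IsIsogenous X (S.prod T) →
      (BettiUniverse.hodge exists_isReal_hodgeModel_holds hX 1).mtRank ∈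
        ({2, 3, 4, 5, 6, 7, 8, 9, 10, 11, 12, 13, 14, 15, 16, 17, 18, 20, 22, 23, 24, 25, 26, 28, 32} : Finset ℕ) := by
    intro S T hSs hS2 hTs hT3 hXP
    have h := mtRank_hodge_one_mem_of_isIsogenous_simpleSurface_prod_simpleThreefold hX hSs hS2 hTs hT3 hXP
    simp only [Set.mem_insert_iff, Set.mem_singleton_iff, Finset.mem_insert, Finset.mem_singleton] at h ⊢
    omega
  have leaf113 : ∀ {T E₁ E₂ : AbelianVariety ℂ}, T.IsSimple → T.dim = 3 → E₁.dim = 1 → E₂.dim = 1 → IsIsogenous X (T.prod (E₁.prod E₂)) →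
      (BettiUniverse.hodge exists_isReal_hodgeModel_holds hX 1).mtRank ∈
        ({2, 3, 4, 5, 6, 7, 8, 9, 10, 11, 12, 13, 14, 15, 16, 17, 18, 20, 22, 23, 24, 25, 26, 28, 32} : Finset ℕ) := by
    intro T E₁ E₂ hTs hT3 hE₁1 hE₂1 hXP
    have h := mtRank_hodge_one_mem_of_isIsogenous_isSimple_threefold_prod_curves hX hTs hT3 hE₁1 hE₂1 hXP
    simp only [Finset.mem_insert, Finset.mem_singleton] at h ⊢
    omega
  have leaf122 : ∀ {E S S' : AbelianVariety ℂ}, E.dim = 1 → S.IsSimple → S.dim = 2 → S'.IsSimple → S'.dim = 2 → IsIsogenous X (E.prod (S.prod S')) →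
      (BettiUniverse.hodge exists_isReal_hodgeModel_holds hX 1).mtRank ∈
        ({2, 3, 4, 5, 6, 7, 8, 9, 10, 11, 12, 13, 14, 15, 16, 17, 18, 20, 22, 23, 24, 25, 26, 28, 32} : Finset ℕ) := by
    intro E S S' hE1 hSs hS2 hS's hS'2 hXP
    have h := mtRank_hodge_one_mem_of_isIsogenous_curve_prod_simpleSurfaces hX hE1 hSs hS2 hS's hS'2 hXP
    simp only [Finset.mem_insert, Finset.mem_singleton] at h ⊢
    omega
  have leaf2111 : ∀ {S E₀ E₁ E₂ : AbelianVariety ℂ}, S.IsSimple → S.dim = 2 → E₀.dim = 1 → E₁.dim = 1 → E₂.dim = 1 →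
      IsIsogenous X (S.prod (E₀.prod (E₁.prod E₂))) →
      (BettiUniverse.hodge exists_isReal_hodgeModel_holds hX 1).mtRank ∈
        ({2, 3, 4, 5, 6, 7, 8, 9, 10, 11, 12, 13, 14, 15, 16, 17, 18, 20, 22, 23, 24, 25, 26, 28, 32} : Finset ℕ) := by
    intro S E₀ E₁ E₂ hSs hS2 hE₀1 hE₁1 hE₂1 hXP
    have hXB : IsIsogenous X (S.prod (⨁ (![E₀, E₁, E₂] : Fin 3 → AbelianVariety ℂ))) :=
      hXP.trans ((IsIsogenous.refl S).prod (biproduct_three_isIsogenous_prod_prod ![E₀, E₁, E₂]).symm')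
    have h := mtRank_hodge_one_mem_of_isIsogenous_simpleSurface_prod_biproduct_three_curves hX hSs hS2 (E := ![E₀, E₁, E₂])
      (fun j => by fin_cases j <;> assumption) hXB
    simp only [Finset.mem_insert, Finset.mem_singleton] at h ⊢
    omega
  have leaf5 : ∀ {E₀ E₁ E₂ E₃ E₄ : AbelianVariety ℂ}, E₀.dim = 1 → E₁.dim = 1 → E₂.dim = 1 → E₃.dim = 1 → E₄.dim = 1 →
      IsIsogenous X (E₀.prod (E₁.prod (E₂.prod (E₃.prod E₄)))) →
      (BettiUniverse.hodge exists_isReal_hodgeModel_holds hX 1).mtRank ∈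
        ({2, 3, 4, 5, 6, 7, 8, 9, 10, 11, 12, 13, 14, 15, 16, 17, 18, 20, 22, 23, 24, 25, 26, 28, 32} : Finset ℕ) := by
    intro E₀ E₁ E₂ E₃ E₄ h₀ h₁ h₂ h₃ h₄ hXP
    have hXB := hXP.trans (isIsogenous_prod_prod_prod_prod_biproduct_five E₀ E₁ E₂ E₃ E₄)
    have h := mtRank_hodge_one_mem_of_biproduct_five_curves hX (E := ![E₀, E₁, E₂, E₃, E₄]) (fun j => by fin_cases j <;> assumption) hXB
    simp only [Finset.mem_insert, Finset.mem_singleton] at h ⊢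
    omega
  obtain ⟨A, B, hdims, hXP⟩ := exists_prod_isIsogenous_of_not_isSimple_fivefold hX5 hns
  rcases hdims with ⟨hA1, hB4⟩ | ⟨hA2, hB3⟩
  · -- curve × fourfold; the fourfold is not simple
    have hBns : ¬ B.IsSimple := h4 A B hA1 hB4 hXP
    obtain ⟨A', B', hdims', hB⟩ := exists_prod_isIsogenous_of_not_isSimple_fourfold hB4 hBns
    have hXP' : IsIsogenous X (A.prod (A'.prod B')) := hXP.trans ((IsIsogenous.refl A).prod hB)
    rcases hdims' with ⟨hA'1, hB'3⟩ | ⟨hA'2, hB'2⟩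
    · -- `E × (E' × T)`
      by_cases hB's : B'.IsSimple
      · exact leaf113 hB's hB'3 hA1 hA'1 ((hXP'.trans (Literature.AlgebraicGeometry.HodgeTheory.isIsogenous_prod_assoc A A' B').symm').trans
          (isIsogenous_prod_comm (A.prod A') B'))
      · obtain ⟨E'', S'', hE''1, hS''2, hT⟩ := exists_curve_prod_surface_isIsogenous_of_not_isSimple_threefold hB'3 hB's
        have hXQ : IsIsogenous X (A.prod (A'.prod (E''.prod S''))) := hXP'.trans ((IsIsogenous.refl A).prod ((IsIsogenous.refl A').prod hT.symm'))
        by_cases hS''s : S''.IsSimple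
        · exact leaf2111 hS''s hS''2 hA1 hA'1 hE''1 (hXQ.trans (isIsogenous_prod_prod_prod_rotate A A' E'' S''))
        · obtain ⟨E₃, E₄, hE₃1, hE₄1, hS''⟩ := exists_isIsogenous_prod_of_not_isSimple_surface hS''2 hS''s
          exact leaf5 hA1 hA'1 hE''1 hE₃1 hE₄1
            (hXQ.trans ((IsIsogenous.refl A).prod ((IsIsogenous.refl A').prod ((IsIsogenous.refl E'').prod hS''))))
    · -- `E × (S × S')`
      by_cases hA's : A'.IsSimple <;> by_cases hB's : B'.IsSimple
      · exact leaf122 hA1 hA's hA'2 hB's hB'2 hXP'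
      · obtain ⟨E₃, E₄, hE₃1, hE₄1, hS'⟩ := exists_isIsogenous_prod_of_not_isSimple_surface hB'2 hB's
        have hXQ : IsIsogenous X (A'.prod (A.prod (E₃.prod E₄))) :=
          ((hXP'.trans ((IsIsogenous.refl A).prod ((IsIsogenous.refl A').prod hS'))).trans
            (Literature.AlgebraicGeometry.HodgeTheory.isIsogenous_prod_assoc A A' (E₃.prod E₄)).symm').trans
            (((isIsogenous_prod_comm A A').prod (IsIsogenous.refl _)).trans
              (Literature.AlgebraicGeometry.HodgeTheory.isIsogenous_prod_assoc A' A (E₃.prod E₄)))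
        exact leaf2111 hA's hA'2 hA1 hE₃1 hE₄1 hXQ
      · obtain ⟨E₃, E₄, hE₃1, hE₄1, hS⟩ := exists_isIsogenous_prod_of_not_isSimple_surface hA'2 hA's
        have hXQ : IsIsogenous X (B'.prod (A.prod (E₃.prod E₄))) :=
          ((hXP'.trans ((IsIsogenous.refl A).prod ((hS.prod (IsIsogenous.refl B')).trans (isIsogenous_prod_comm (E₃.prod E₄) B')))).trans
            (Literature.AlgebraicGeometry.HodgeTheory.isIsogenous_prod_assoc A B' (E₃.prod E₄)).symm').trans
            (((isIsogenous_prod_comm A B').prod (IsIsogenous.refl _)).trans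
              (Literature.AlgebraicGeometry.HodgeTheory.isIsogenous_prod_assoc B' A (E₃.prod E₄)))
        exact leaf2111 hB's hB'2 hA1 hE₃1 hE₄1 hXQ
      · obtain ⟨E₁, E₂, hE₁1, hE₂1, hS⟩ := exists_isIsogenous_prod_of_not_isSimple_surface hA'2 hA's
        obtain ⟨E₃, E₄, hE₃1, hE₄1, hS'⟩ := exists_isIsogenous_prod_of_not_isSimple_surface hB'2 hB's
        have hXQ : IsIsogenous X (A.prod (E₁.prod (E₂.prod (E₃.prod E₄)))) :=
          (hXP'.trans ((IsIsogenous.refl A).prod (hS.prod hS'))).trans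
            ((IsIsogenous.refl A).prod (Literature.AlgebraicGeometry.HodgeTheory.isIsogenous_prod_assoc E₁ E₂ (E₃.prod E₄)))
        exact leaf5 hA1 hE₁1 hE₂1 hE₃1 hE₄1 hXQ
  · -- surface × threefold
    by_cases hAs : A.IsSimple <;> by_cases hBs : B.IsSimple
    · exact leafT hAs hA2 hBs hB3 hXP
    · obtain ⟨E, S', hE1, hS'2, hT⟩ := exists_curve_prod_surface_isIsogenous_of_not_isSimple_threefold hB3 hBs
      have hXP' : IsIsogenous X (A.prod (E.prod S')) := hXP.trans ((IsIsogenous.refl A).prod hT.symm')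
      by_cases hS's : S'.IsSimple
      · -- `S × (E × S') ∼ E × (S × S')`
        have hXQ : IsIsogenous X (E.prod (A.prod S')) :=
          (hXP'.trans (Literature.AlgebraicGeometry.HodgeTheory.isIsogenous_prod_assoc A E S').symm').trans
            (((isIsogenous_prod_comm A E).prod (IsIsogenous.refl S')).trans (Literature.AlgebraicGeometry.HodgeTheory.isIsogenous_prod_assoc E A S'))
        exact leaf122 hE1 hAs hA2 hS's hS'2 hXQ
      · obtain ⟨E₃, E₄, hE₃1, hE₄1, hS'⟩ := exists_isIsogenous_prod_of_not_isSimple_surface hS'2 hS's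
        exact leaf2111 hAs hA2 hE1 hE₃1 hE₄1 (hXP'.trans ((IsIsogenous.refl A).prod ((IsIsogenous.refl E).prod hS')))
    · obtain ⟨E₁, E₂, hE₁1, hE₂1, hS⟩ := exists_isIsogenous_prod_of_not_isSimple_surface hA2 hAs
      exact leaf113 hBs hB3 hE₁1 hE₂1 ((hXP.trans (hS.prod (IsIsogenous.refl B))).trans (isIsogenous_prod_comm (E₁.prod E₂) B))
    · obtain ⟨E₁, E₂, hE₁1, hE₂1, hS⟩ := exists_isIsogenous_prod_of_not_isSimple_surface hA2 hAs
      obtain ⟨E, S', hE1, hS'2, hT⟩ := exists_curve_prod_surface_isIsogenous_of_not_isSimple_threefold hB3 hBs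
      have hXP' : IsIsogenous X ((E₁.prod E₂).prod (E.prod S')) := hXP.trans (hS.prod hT.symm')
      by_cases hS's : S'.IsSimple
      · -- `(E₁ × E₂) × (E × S') ∼ S' × (E × (E₁ × E₂))`
        have hXQ : IsIsogenous X (S'.prod (E.prod (E₁.prod E₂))) :=
          (hXP'.trans (isIsogenous_prod_comm (E₁.prod E₂) (E.prod S'))).trans
            (((isIsogenous_prod_comm E S').prod (IsIsogenous.refl _)).trans
              (Literature.AlgebraicGeometry.HodgeTheory.isIsogenous_prod_assoc S' E (E₁.prod E₂)))
        exact leaf2111 hS's hS'2 hE1 hE₁1 hE₂1 hXQ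
      · obtain ⟨E₃, E₄, hE₃1, hE₄1, hS'⟩ := exists_isIsogenous_prod_of_not_isSimple_surface hS'2 hS's
        have hXQ : IsIsogenous X (E₁.prod (E₂.prod (E.prod (E₃.prod E₄)))) :=
          (hXP'.trans ((IsIsogenous.refl _).prod ((IsIsogenous.refl E).prod hS'))).trans
            (Literature.AlgebraicGeometry.HodgeTheory.isIsogenous_prod_assoc E₁ E₂ (E.prod (E₃.prod E₄)))
        exact leaf5 hE₁1 hE₂1 hE1 hE₃1 hE₄1 hXQ

/-- **A non-simple complex abelian fivefold with `t ∈ {19, 21, 27, 29, 30, 31}` or `t ≥ 33` is a curve times a simple fourfold** (contrapositive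
reading of the membership theorem). [cite: MoonenZarhin1999LowDim, §3 and §5 (5.4)] -/
theorem exists_curve_prod_simple_fourfold_of_not_isSimple_fivefold (hX : IsSmoothProjective n X.X) (hX5 : X.dim = 5) (hns : ¬ X.IsSimple)
    (ht : haveI := BettiUniverse.finite hX 1
      (BettiUniverse.hodge exists_isReal_hodgeModel_holds hX 1).mtRank ∉
        ({2, 3, 4, 5, 6, 7, 8, 9, 10, 11, 12, 13, 14, 15, 16, 17, 18, 20, 22, 23, 24, 25, 26, 28, 32} : Finset ℕ)) :
    ∃ A B : AbelianVariety ℂ, A.dim = 1 ∧ B.dim = 4 ∧ B.IsSimple ∧ IsIsogenous X (A.prod B) := by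
  by_contra hno
  push Not at hno
  exact ht (mtRank_hodge_one_mem_of_not_isSimple_fivefold hX hX5 hns fun A B hA hB hXP hBs => hno A B hA hB hBs hXP)

end Summit.HodgeConjecture.CorCM

end
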